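import Mathlib.MeasureTheory.Measure.Lebesgue.Complex
import Mathlib.MeasureTheory.Measure.Lebesgue.EqHaar
import Mathlib.MeasureTheory.Measure.Real
import Mathlib.LinearAlgebra.Complex.FiniteDimensional
import Literature.Probability.LatticeModels.MeshCells
import HarnessLib

/-!
# A column without long shallow perfect runs (area count)

Topic: Probability / LatticeModels (fifth file of the "bulk = largest mesh component for every
Jordan domain" theorem, `MeshDomainJordan.lean`; sub-namespace `…LatticeModels.Mesh`). A perfect
cell of the mesh `δℤ²` all of whose corners are at distance `< ε` from `Ωᶜ` (a *shallow* perfect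
cell) lies inside the inner collar `{z ∈ Ω | infDist z Ωᶜ < ε + 2δ}`, and distinct cells are
disjoint. Hence (`exists_column_forall_not_shallowRun`): if the collar has area less than
`(#columns) · M · area B(0, δ/2)`, then some column `k` of any given finite set of columns contains
**no** run of `M` consecutive shallow perfect cells. This is the counting step that provides a
"good column" for the parity argument of `MeshStrayParity.lean`.

Folklore. Mathlib anchors: `MeasureTheory.measureReal_biUnion_finset`,
`Measure.addHaar_real_ball`, `Metric.infDist`. H21 anchors: `Mesh.cell`, `Mesh.IsPerfect`,
`Mesh.ball_cellCenter_subset_cell`, `Mesh.infDist_lt_of_mem_cell` (`MeshColumns.lean`,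
`MeshCells.lean`).
-/

namespace Literature.Probability.LatticeModels.Mesh

open Set Metric MeasureTheory

noncomputable section

variable {Ω : Set ℂ} {δ : ℝ}

/-- Distinct cells are disjoint (`δ > 0`). [folklore] -/
theorem disjoint_cell (hδ : 0 < δ) {k j k' j' : ℤ} (h : (k, j) ≠ (k', j')) :
    Disjoint (cell δ k j) (cell δ k' j') := by
  rw [Set.disjoint_left]
  rintro z ⟨⟨h1, h2⟩, h3, h4⟩ ⟨⟨h5, h6⟩, h7, h8⟩
  have hk : k = k' := by
    have a1 : (k : ℝ) < k' + 1 := lt_of_mul_lt_mul_left (h1.trans h6) hδ.le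
    have a2 : (k' : ℝ) < k + 1 := lt_of_mul_lt_mul_left (h5.trans h2) hδ.le
    have : k < k' + 1 := by exact_mod_cast a1
    have : k' < k + 1 := by exact_mod_cast a2
    omega
  have hj : j = j' := by
    have a1 : (j : ℝ) < j' + 1 := lt_of_mul_lt_mul_left (h3.trans h8) hδ.le
    have a2 : (j' : ℝ) < j + 1 := lt_of_mul_lt_mul_left (h7.trans h4) hδ.le
    have : j < j' + 1 := by exact_mod_cast a1
    have : j' < j + 1 := by exact_mod_cast a2
    omega
  exact h (by rw [hk, hj])

/-- **Some column has no long shallow perfect run.** Let `Kset` be a finite set of columns and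
`M : ℕ`. If the inner collar `{z ∈ Ω | infDist z Ωᶜ < ε + 2δ}` has area
`< #Kset · M · area B(0, δ/2)`, then for some `k ∈ Kset` there is no `j` such that the `M` cells
`(k, j+1), …, (k, j+M)` are all perfect with all corners at distance `< ε` from `Ωᶜ` (the
`δ/2`-balls about the centres of such cells would be disjoint subsets of the collar).
[folklore] -/
theorem exists_column_forall_not_shallowRun (hΩb : Bornology.IsBounded Ω) (hδ : 0 < δ) {ε : ℝ}
    (Kset : Finset ℤ) (M : ℕ)
    (harea : volume.real {z ∈ Ω | infDist z Ωᶜ < ε + 2 * δ} <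
      Kset.card * M * ((δ / 2) ^ 2 * volume.real (ball (0 : ℂ) 1))) :
    ∃ k ∈ Kset, ∀ j : ℤ, ¬ ∀ m : ℕ, m < M →
      IsPerfect Ω δ k (j + 1 + m) ∧
        ∀ a b : Bool, infDist (meshPoint δ (corner k (j + 1 + m) a b)) Ωᶜ < ε := by
  by_contra hcon
  push Not at hcon
  -- choose a run in every column
  choose f hf using hcon
  set T : Set ℂ := {z ∈ Ω | infDist z Ωᶜ < ε + 2 * δ} with hT
  set P : Finset (ℤ × ℕ) := Kset ×ˢ Finset.range M with hP
  -- the centre of the `m`-th cell of the chosen run in column `k`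
  let ctr : ℤ × ℕ → ℂ := fun p =>
    if h : p.1 ∈ Kset then cellCenter δ p.1 (f p.1 h + 1 + p.2) else 0
  have hctr : ∀ p ∈ P, ∃ h : p.1 ∈ Kset, ctr p = cellCenter δ p.1 (f p.1 h + 1 + p.2) ∧ p.2 < M := by
    intro p hp
    rw [hP, Finset.mem_product, Finset.mem_range] at hp
    exact ⟨hp.1, by simp only [ctr, dif_pos hp.1], hp.2⟩
  -- the balls are pairwise disjoint
  have hdisj : (P : Set (ℤ × ℕ)).PairwiseDisjoint fun p => ball (ctr p) (δ / 2) := by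
    rintro ⟨p1, p2⟩ hp ⟨q1, q2⟩ hq hpq
    obtain ⟨hp1, hpe, hpM⟩ := hctr _ hp
    obtain ⟨hq1, hqe, hqM⟩ := hctr _ hq
    rw [Function.onFun, hpe, hqe]
    refine (disjoint_cell hδ (k := p1) (j := f p1 hp1 + 1 + p2) (k' := q1)
      (j' := f q1 hq1 + 1 + q2) ?_).mono (ball_cellCenter_subset_cell δ _ _)
      (ball_cellCenter_subset_cell δ _ _)
    intro heq
    simp only [Prod.mk.injEq] at heq
    obtain ⟨h1, h2⟩ := heq
    apply hpq
    subst h1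
    have : (p2 : ℤ) = q2 := by omega
    have : p2 = q2 := by exact_mod_cast this
    rw [this]
  -- and contained in the collar
  have hsub : (⋃ p ∈ P, ball (ctr p) (δ / 2)) ⊆ T := by
    intro z hz
    simp only [mem_iUnion, exists_prop] at hz
    obtain ⟨p, hp, hz⟩ := hz
    obtain ⟨hp1, hpe, hpM⟩ := hctr p hp
    rw [hpe] at hz
    have hzc := ball_cellCenter_subset_cell δ _ _ hz
    obtain ⟨hperf, hsh⟩ := hf p.1 hp1 p.2 hpM
    exact ⟨hperf.1 hzc, infDist_lt_of_mem_cell hδ (hsh false false) hzc⟩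
  have hTfin : volume T ≠ ⊤ := (hΩb.subset fun z hz => hz.1).measure_lt_top.ne
  have hcard : (P.card : ℝ) = Kset.card * M := by
    rw [hP, Finset.card_product, Finset.card_range]; push_cast; ring
  have key : (P.card : ℝ) * ((δ / 2) ^ 2 * volume.real (ball (0 : ℂ) 1)) ≤ volume.real T :=
    calc (P.card : ℝ) * ((δ / 2) ^ 2 * volume.real (ball (0 : ℂ) 1))
        = ∑ p ∈ P, volume.real (ball (ctr p) (δ / 2)) := by
          rw [← nsmul_eq_mul, ← Finset.sum_const]
          refine Finset.sum_congr rfl fun p _ => ?_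
          rw [← Measure.addHaar_real_closedBall_eq_addHaar_real_ball volume (ctr p) (δ / 2),
            Measure.addHaar_real_closedBall volume _ (by positivity : (0 : ℝ) ≤ δ / 2),
            Complex.finrank_real_complex]
      _ = volume.real (⋃ p ∈ P, ball (ctr p) (δ / 2)) :=
          (measureReal_biUnion_finset hdisj (fun _ _ => measurableSet_ball)
            (fun _ _ => measure_ball_lt_top.ne)).symm
      _ ≤ volume.real T := measureReal_mono hsub hTfin
  rw [hcard] at key
  linarith

end

end Literature.Probability.LatticeModels.Mesh
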